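import Summits.QuantumFields.YangMills.Theses.UnitScaleTilt
import Summits.QuantumFields.YangMills.Theorems.UnitScaleTiltHistoryTailOfPinnedHeightTail
import Summits.QuantumFields.YangMills.Theorems.UnitScaleTiltHistoryTailOfPinnedHeightTailFreeRate
import Summits.QuantumFields.YangMills.Theorems.UV3PinnedStepV3FaceOfPackageV3
import Summits.QuantumFields.YangMills.Theorems.UV3UnitEnvelopeFaceOfPackageV3
import Summits.QuantumFields.YangMills.Theorems.AlphaInputsT3ACRecordWitness
import Summits.QuantumFields.YangMills.Theorems.UV3PinnedStepKnitOfPackageV3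
import Summits.QuantumFields.YangMills.Theorems.UV3PinnedStepOrganOfMassEnvelopeV3
import Summits.QuantumFields.YangMills.Theorems.UV3UnitEnvelopeOrganOfMassEnvelopeV3
import Literature.MathematicalPhysics.QuantumFieldTheory.Balaban1983to89.T3RestrictedUnitDensity
import Literature.MathematicalPhysics.QuantumFieldTheory.Balaban1983to89.T3CruxEstimates

/-!
# LINE «PinnedStability» v4 — PACKAGE-LEVEL RE-CUT of the 19936 skeleton (crux stmt-QuantumFields-19936 `UnitScaleTilt.HistoryTailL`): the registry
# names the (α) organ ONCE and the one displayed Jacobian row hJ; the v3 texts are DERIVED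

Seat ym-r3-idea-2 g17 (lens «nearmiss»), 2026-08-30; ★★OWNER WORD 59 (one flip v3 → v4 after KNIT′ + FILE 3) and RULING №38 (guarded sockets).
HONEST: nothing of `HistoryTailL` (19936), of R3 (YM₃ on T³ — NOT d = 4, NOT infinite volume, NOT a mass gap, NOT Clay) is proved here; no summit is proved by a line.

MEASURED DEFICIT (the near miss): the v3 registry rows `stub_pinnedStep` (S, 1065 ch) and `stub_unitEnvelope` (U, 295 ch) are, by kernel, consequences of
the v3 (α) package and ONE displayed row — the K-uniform top-level a.e. MASS ENVELOPE hJ of the pinned transported history masses of `blockAvg ℰp` (print: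
`≤ 1` by Haar compatibility (b) p.23 of [Balaban1985Averaging]; tree: OPEN, the k-fold Jacobian row, lit GAPS G-B10-10(c); ★★★ director R529 ∕ JOB HJ: the flat
letter SURVIVES structurally in the Haar currency, ★★OWNER WORD 64): S ⟸ ✓p749641 `UV3PinnedStepV3FaceOfPackageV3.stub_pinnedStepV3_of_packageV3_of_purePinTop
(hpkg)(π)(hPinA)` ⟸ ✓p753361 `UV3PinnedStepKnitOfPackageV3.hPinA_of_pinnedLF_v3 (π)(hSiiᵥ₃)` ⟸ w6 g7 `UV3PinnedStepOrganOfMassEnvelopeV3` ★★★`AlphaInputsT3AC.OfV3At.hSii_of_massEnvelope (h)(hc)(γ hγ hγ1)(m)(hJ)`; U ⟸ ✓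
`UV3UnitEnvelopeFaceOfPackageV3.stub_unitEnvelope_of_packageV3_of_lfTop_ae (hpkg)(π)(hlf a.e.)` ⟸ w6 g7 `UV3UnitEnvelopeOrganOfMassEnvelopeV3` ★★★`AlphaInputsT3AC.OfV3At.hlf_ae_of_massEnvelope (h)(hc)(γ hγ hγ1)(π)(hJ)`.  So the two XL rows of v3
double-count ONE organ and display ONE row; v4 registers exactly these, ONCE:
* §1 `stub_laneRecordsV3` (XXL: the (α) LANE RECORDS `AlphaInputsT3ACv3Rec L` for odd `L > 1` — VERBATIM the cell's established stub text of the
  `FluctuationComparisonRegPrL` lineage, so one supplier closes both rows; sorry-free bridge `hpkg_of_laneRecordsV3` to the faces' GUARDED socket `∀ L, 1 < L → …`,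
  RULING №38-clean) · `stub_hJ` (XL: w6 g7's hJ letter in the v3 currency, closed over the package binders; BC7 CLEAN).
* §1a (sorry-free) `purePinTop_of_hJ` (the faces' `hPinA`, ∀ π) and `lfTop_ae_of_hJ` (the U-face's a.e. `hlf`, ∀ π) from `stub_hJ` by the landed knits.
* §1b (sorry-free) the v3 registered texts `pinnedStep_of_package` ∕ `unitEnvelope_of_package` := the two faces applied to §1∕§1a with the trivial polymer datum `π`.
* §2 `pinnedHeightTail_of` (v3, sorry-free) · §3 = the socket K-19′ ✓p748552 BY NAME (v3's inline K-19♭ deleted — critic P1 paid) · §4 `HistoryTailL_of_stubs`, the UNIQUE local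
  theorem concluding the crux BY NAME with zero extra hypotheses (★★OWNER RULING №39; v3's conditional `HistoryTailL_of (hStep)(hLow)` is inlined away).
Sorries ONLY in the two `stub_*`.  [cite: Balaban1985UV3, (38)-(47) pp.266-267 and (67)-(71) pp.273-274; Balaban1985Averaging, (b) p.23]
-/

namespace Summit.QuantumFields.YangMills.Cruxes.HistoryTailL.PinnedStability

open scoped BigOperators Topology Classical MeasureTheory ProbabilityTheory Matrix
open Filter Set Function TopologicalSpace MeasureTheory
open Literature.MathematicalPhysics.QuantumFieldTheory.Balaban1983to89
open Literature.MathematicalPhysics.QuantumFieldTheory.Balaban1983to89.T3ContinuumYM3Torus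
open Literature.MathematicalPhysics.QuantumFieldTheory.Balaban1983to89.T3UnitScaleTilt
open Literature.MathematicalPhysics.QuantumFieldTheory.Balaban1983to89.T3UnitLawDensityEML
open Literature.MathematicalPhysics.QuantumFieldTheory.Balaban1983to89.T3RestrictedUnitDensity
open Literature.MathematicalPhysics.QuantumFieldTheory.Balaban1983to89.T3CruxEstimates
open Literature.MathematicalPhysics.QuantumFieldTheory.Balaban1983to89.T3AlphaInputsAC
open Literature.MathematicalPhysics.QuantumFieldTheory.Balaban1985CMP102
open Literature.MathematicalPhysics.QuantumFieldTheory.Balaban1985CMP102.Setting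
open Summit.QuantumFields.Balaban3D.Carriers
open Summit.QuantumFields.Balaban3D.Proofs.Primitives
open Summit.QuantumFields.YangMills.Theorems (AlphaInputsT3AC.OfV3At AlphaInputsT3AC.PolymerT3 AlphaInputsT3AC.OfV3At.dataT3v3 AlphaInputsT3AC.exists_alphaConsts
  T3Scales sq_min_one_le)
open Summit.QuantumFields.YangMills.Theorems.UV3PinnedStepV3FaceOfPackageV3 (stub_pinnedStepV3_of_packageV3_of_purePinTop)
open Summit.QuantumFields.YangMills.Theorems.UV3UnitEnvelopeFaceOfPackageV3 (stub_unitEnvelope_of_packageV3_of_lfTop_ae)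
open Summit.QuantumFields.YangMills.Theorems.UV3PinnedStepKnitOfPackageV3 (hPinA_of_pinnedLF_v3)
open Summit.QuantumFields.YangMills.Theorems.UnitScaleTiltHistoryTailOfPinnedHeightTailFreeRate (historyTailL_of_pinnedHeightTail_freeRate)
open Summit.QuantumFields.YangMills.Theorems (AlphaInputsT3AC.OfV3At.pkgAtV3)
open Summit.QuantumFields.YangMills.Theorems (PinnedStep.massP)
open Literature.MathematicalPhysics.QuantumFieldTheory.Balaban1983to89.Missing (partitionFn partitionFn_pos' measurable_plaqHol
  isProbabilityMeasure_fieldMeasure)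
open Literature.MathematicalPhysics.QuantumFieldTheory.Balaban1983to89.T3BareTailProfile (bareTailAt)
open Summit.QuantumFields.YangMills.Theorems.HistoryTailOfTwoSided (exists_perHeight_bound geometric_profile card_plaq_le_pow)
open Summit.QuantumFields.YangMills.Theorems.PoincareLipschitzHistoryTailOfLinearTail (real_not_plaqSmall_inter_le_sum)
open Summit.QuantumFields.YangMills.Theorems.PoincareLipschitzHistoryTailOfLinearTailDeep (historyTailAt_of_bare_finestBad_deep)

/-! ## §1 The two package-level stubs (the ONLY sorries) -/

/-- stub (XXL · THE ORGAN, registered ONCE, BY THE CELL'S ESTABLISHED NAME AND TEXT): the (α) LANE RECORDS, version 3 — for every odd block size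
`L > 1` the record-parametric closed proposition `AlphaInputsT3ACv3Rec L` (`∃ b₁ p₁, ∀ b₀ p₀ ⪰, ∃ 𝔠 a₀ a₁, 𝔠.b₀ = b₀ ∧ 𝔠.p₀ = p₀ ∧ … ∧ ∀ F, F.L = L → OfV3At F 𝔠 a₀ a₁`):
Bałaban's inductive small-∕large-field bounds (38)–(47) with the AC tower for SU(2) `T³` families — the pub-balaban3d lane's target.  VERBATIM the text of
`stub_laneRecordsV3` of the `FluctuationComparisonRegPrL` lineage (`Cruxes/FluctuationComparisonRegPrL/Lines/birth_v5j4.lean`), so ONE supplier theorem closes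
both rows with `--supports`.  WHY IT MIGHT FAIL: it is the content of [Balaban1985UV3] Thm 2 + [Balaban1985Variational] Thm 1 + [Balaban1988Convergent] for pure
YM₃ at the tree's V3 interface (pinned masses, (40) windows inside the rows); the interface is the lane's moving frontier (`…v3RecChi`, `…v4RecChi` exist).
[cite: Balaban1985UV3, Thm 2 p.272 and (38)-(47) pp.266-267; Balaban1985Variational, Thm 1 (8) p.279] -/
theorem stub_laneRecordsV3 : ∀ L : ℕ, Odd L → 1 < L → Summit.QuantumFields.YangMills.Theorems.AlphaInputsT3ACv3Rec L := by
  sorry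

/-- BRIDGE (sorry-free): the lane records give the faces' package binder `hpkg` at EVERY `L > 1` — odd `L` from the record at the floors `(b₁, p₁)` themselves,
even `L` vacuously (no `T3Family` has even `L`: `F.hL.1`) at the arithmetic witness record `AlphaInputsT3AC.exists_alphaConsts` (✓ `AlphaInputsT3ACRecordWitness` §1). -/
theorem hpkg_of_laneRecordsV3 (h : ∀ L : ℕ, Odd L → 1 < L → Summit.QuantumFields.YangMills.Theorems.AlphaInputsT3ACv3Rec L) :
    ∀ L : ℕ, 1 < L → ∃ (𝔠 : AlphaConsts L (suGroupModel 2).N) (a₀ a₁ : ℝ),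
      (0 < a₀ ∧ 0 < a₁ ∧ 𝔠.B₃ * a₁ ≤ a₀) ∧ ∀ (F : T3Family) (hF : F.L = L), AlphaInputsT3AC.OfV3At F (hF ▸ 𝔠) a₀ a₁ := by
  intro L hL
  by_cases hodd : Odd L
  · obtain ⟨b₁, p₁, hrec⟩ := h L hodd hL
    obtain ⟨𝔠, a₀, a₁, -, -, ha₀, ha₁, hB, hOf⟩ := hrec b₁ p₁ le_rfl le_rfl
    exact ⟨𝔠, a₀, a₁, ⟨ha₀, ha₁, hB⟩, hOf⟩
  · obtain ⟨𝔠, h𝔠⟩ := AlphaInputsT3AC.exists_alphaConsts hL (suGroupModel 2).N (B₃ := 1) one_pos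
    refine ⟨𝔠, 1, 1, ⟨one_pos, one_pos, by rw [h𝔠, one_mul]⟩, ?_⟩
    intro F hF
    exact absurd (hF ▸ F.hL.1) hodd

/-- stub (XL · THE ONE DISPLAYED ROW hJ — THE K-UNIFORM TOP-LEVEL A.E. MASS ENVELOPE OF THE PINNED TRANSPORTED HISTORY MASSES, v3 currency; w6 g7's
letter (the hypothesis of `OfV3At.hSii_of_massEnvelope` ∕ `OfV3At.hlf_ae_of_massEnvelope`) CLOSED over the package binders `F, 𝔠, a₀, a₁, h, hc, γ`): for every admissible NON-TRIVIAL history `r` of a run `K`,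
`massP_K(r, W) ≤ e^{A₁}` for `dV_K`-a.e. `W`, ONE `A₁` for all `K`.  In print this is `≤ 1` (Haar compatibility of the averaging, [Balaban1985Averaging] (b) p.23, used
silently in [Balaban1985UV3] (41)∕(48)); for the tree's `blockAvg ℰp` single bonds are exactly Haar (lit ✓`B10Eq2HaarCompatibility`) but the joint law is not
(`emlDensity ≢ 1`), so hJ is the k-fold JACOBIAN row — necessity∕sufficiency typed in ✓`BalabanUVNodesN08TrivialHistoryIteratedTransport` (segment densities
`ρ_{j→K} ≤ e^{A₁}` a.e.); JOB HJ (instr g8, ★★OWNER WORD 64): structurally FLAT in the Haar currency (off-guard = axial ⇒ Haar exactly; guard mass ≤ h^{13} per bond at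
L = 2), so the live content is the lopsided cross-level bookkeeping (N08-EML-JACOBIAN §4).  WHY IT MIGHT FAIL: a K-uniform ess-sup needs the fine-level density
bumps to launder under further averaging faster than the branching factor L³; un-laundered the bound is exp(c·8^K). [cite: Balaban1985Averaging, (b) p.23;
Balaban1985UV3, (41) p.266 and (48) p.267] -/
theorem stub_hJ :
    ∀ (F : T3Family) (𝔠 : AlphaConsts F.L (suGroupModel 2).N) (a₀ a₁ : ℝ) (h : AlphaInputsT3AC.OfV3At F 𝔠 a₀ a₁)
      (hc : 0 < a₀ ∧ 0 < a₁ ∧ 𝔠.B₃ * a₁ ≤ a₀) (γ : ℝ) (hγ : 0 < γ) (hγ1 : γ ≤ (min 𝔠.gamma0 1) ^ 2),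
      ∃ A₁ : ℝ, ∀ (K : ℕ) (r : Hist (F.P K) K),
        Hist.Admissible 𝔠.lane.carrier.M₁ (rcolOf (T3Scales F γ hγ (hγ1.trans (sq_min_one_le _ 𝔠.gamma0_pos)) K) 𝔠.lane.carrier) K r →
        r ≠ Hist.triv (F.P K) K →
        ∀ᵐ W ∂(fieldMeasure (F.P K) K (Matrix.specialUnitaryGroup (Fin 2) ℂ)),
          PinnedStep.massP 𝔠.lane (h.pkgAtV3 hc γ hγ hγ1 K).X K r W ≤ Real.exp A₁ := by
  sorry

/-! ## §1a The faces' displayed rows, DERIVED from `stub_hJ` by the landed knits (sorry-free) -/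

/-- The v3 S-face's `hPinA` (✓p749641's binder, for every polymer datum `π`) from `stub_hJ`: per block size the threshold `γ₁ := 1` (hJ is coupling-uniform),
per family `subst hF`, then w6 g7's `AlphaInputsT3AC.OfV3At.hSii_of_massEnvelope` (✓p753361 §1's `hSii` binder VERBATIM) feeds ✓p753361 §2 `hPinA_of_pinnedLF_v3`. -/
theorem purePinTop_of_hJ :
    ∀ (π : ∀ F : T3Family, AlphaInputsT3AC.PolymerT3 F) (L : ℕ) (𝔠 : AlphaConsts L (suGroupModel 2).N) (a₀ a₁ : ℝ),
      (0 < a₀ ∧ 0 < a₁ ∧ 𝔠.B₃ * a₁ ≤ a₀) →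
      ∀ (hOf : ∀ (F : T3Family) (hF : F.L = L), AlphaInputsT3AC.OfV3At F (hF ▸ 𝔠) a₀ a₁),
        ∀ (m : ℕ), 0 < m →
          ∃ γ₁ : ℝ, 0 < γ₁ ∧ ∀ (F : T3Family) (hF : F.L = L)
            (hc' : 0 < a₀ ∧ 0 < a₁ ∧ (hF ▸ 𝔠).B₃ * a₁ ≤ a₀) (γ : ℝ) (hγ : 0 < γ) (hγ1' : γ ≤ (min (hF ▸ 𝔠).gamma0 1) ^ 2), γ ≤ γ₁ →
            ∃ (Cu c : ℝ) (A : ℕ), 0 < c ∧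
              ∀ (K j : ℕ), 1 ≤ j → j + 2 ≤ K → j + (K - 1) / m ≤ K → ∀ (a : Plaq (F.P K) j),
                ∀ᵐ V ∂(fieldMeasure (F.P K) K (Matrix.specialUnitaryGroup (Fin 2) ℂ)),
                  resDensity F γ K
                    {U : GaugeField (F.P K) 0 (Matrix.specialUnitaryGroup (Fin 2) ℂ) |
                      θBal F.L γ (hF ▸ 𝔠).b₀ (hF ▸ 𝔠).p₀ (K - j) ≤ GaugeGroup.dist1 (GaugeField.plaqHol
                        (Averaging.iter (fun i' => BlockAveraging.blockAvg (P := F.P K) (j := i') ℰp) j U) a)}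
                    K V ≤
                  Real.exp (-(((hOf F hF).dataT3v3 hc' γ hγ hγ1' (π F)).Ecst K K) + Cu) *
                    ((F.scheme ℰp γ).β (K - j) ^ A *
                      Real.exp (-(c * B10.pFun (hF ▸ 𝔠).b₀ (hF ▸ 𝔠).p₀ (Real.sqrt (γ * ((F.L : ℝ)⁻¹) ^ (K - j))) ^ 2))) :=
  fun π => hPinA_of_pinnedLF_v3 π
    (fun L 𝔠 a₀ a₁ _ hOf m _ => ⟨1, one_pos, fun F hF hc' γ hγ hγ1' _ => by
      subst hF
      exact (hOf F rfl).hSii_of_massEnvelope hc' γ hγ hγ1' m (stub_hJ F 𝔠 a₀ a₁ (hOf F rfl) hc' γ hγ hγ1')⟩)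

/-- The v3 U-face's top-leaf row `hlf`, READ A.E. (★★OWNER RULING №32; the binder of ✓`stub_unitEnvelope_of_packageV3_of_lfTop_ae`, for every `π`) from `stub_hJ`
by w6 g7's `AlphaInputsT3AC.OfV3At.hlf_ae_of_massEnvelope` (`CZ := max A₁ 0 + (6∕log L)(2L^m)³`; `wtP ≤ massP`, `massP(triv) = 1` — no trivial-history row in v3). -/
theorem lfTop_ae_of_hJ :
    ∀ (π : ∀ F : T3Family, AlphaInputsT3AC.PolymerT3 F) (F : T3Family) (𝔠 : AlphaConsts F.L (suGroupModel 2).N) (a₀ a₁ : ℝ) (h : AlphaInputsT3AC.OfV3At F 𝔠 a₀ a₁)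
      (hc : 0 < a₀ ∧ 0 < a₁ ∧ 𝔠.B₃ * a₁ ≤ a₀) (γ : ℝ) (hγ : 0 < γ) (hγ1 : γ ≤ (min 𝔠.gamma0 1) ^ 2),
      ∃ CZ : ℝ, ∀ (K : ℕ), 1 ≤ K → ∀ᵐ W ∂fieldMeasure (F.P K) K (Matrix.specialUnitaryGroup (Fin 2) ℂ),
        (h.dataT3v3 hc γ hγ hγ1 (π F)).LF K K W
            (fun r => -((h.dataT3v3 hc γ hγ hγ1 (π F)).mainT K K r W) + (h.dataT3v3 hc γ hγ hγ1 (π F)).Zterm K K r) ≤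
          Real.exp CZ :=
  fun π F 𝔠 a₀ a₁ h hc γ hγ hγ1 => h.hlf_ae_of_massEnvelope hc γ hγ hγ1 (π F) (stub_hJ F 𝔠 a₀ a₁ h hc γ hγ hγ1)

/-! ## §1b The v3 registered texts, DERIVED (sorry-free): the faces applied to §1 with the trivial polymer datum -/

/-- S-step (v3 text, 1065 chars) from the package + the pure-pin top row, by ✓p749641. -/
theorem pinnedStep_of_package :
    ∀ (L : ℕ), ∃ (b₁' p₁' : ℝ), ∀ (b₀ p₀ : ℝ), b₁' ≤ b₀ → p₁' ≤ p₀ → 0 < b₀ → 2 < p₀ → ∀ (m : ℕ), 0 < m →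
      ∃ γ₁ : ℝ, 0 < γ₁ ∧ γ₁ ≤ 1 ∧ ∀ (F : T3Family) (γ : ℝ), F.L = L → 0 < γ → γ ≤ γ₁ →
        ∃ (b p Cu c : ℝ) (A : ℕ), 0 < b ∧ 1 ≤ p ∧ 0 < c ∧ ∀ (K j : ℕ), 1 ≤ j → j + 2 ≤ K → j + (K - 1) / m ≤ K → ∀ (a : Plaq (F.P K) j) (M : ℝ),
          (∀ᵐ V ∂(fieldMeasure (F.P K) K (Matrix.specialUnitaryGroup (Fin 2) ℂ)), emlDensity F γ K K V ≤ M) →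
          ∀ᵐ V ∂(fieldMeasure (F.P K) K (Matrix.specialUnitaryGroup (Fin 2) ℂ)),
            resDensity F γ K
              ({U : GaugeField (F.P K) 0 (Matrix.specialUnitaryGroup (Fin 2) ℂ) |
                  θBal F.L γ b₀ p₀ (K - j) ≤ GaugeGroup.dist1 (GaugeField.plaqHol
                    (Averaging.iter (fun i' => BlockAveraging.blockAvg (P := F.P K) (j := i') ℰp) j U) a)} ∩
                {U : GaugeField (F.P K) 0 (Matrix.specialUnitaryGroup (Fin 2) ℂ) | ∀ i, i < j →
                  PlaqSmall (θBal F.L γ b₀ p₀ (K - i))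
                    (Averaging.iter (fun i' => BlockAveraging.blockAvg (P := F.P K) (j := i') ℰp) i U)})
              K V ≤
            M * Real.exp Cu *
              ((F.scheme ℰp γ).β (K - j) ^ A * Real.exp (-(c * B10.pFun b p (Real.sqrt (γ * ((F.L : ℝ)⁻¹) ^ (K - j))) ^ 2))) :=
  stub_pinnedStepV3_of_packageV3_of_purePinTop (hpkg_of_laneRecordsV3 stub_laneRecordsV3)
    (fun F => (⟨fun _ _ _ _ => ∅, fun _ _ _ _ => 0, fun _ _ Y => Y, fun _ _ _ => 0⟩ : AlphaInputsT3AC.PolymerT3 F))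
    (purePinTop_of_hJ _)

/-- S-low (v3 = v2′ text, 295 chars) from the package + the LF top row read a.e., by ✓`stub_unitEnvelope_of_packageV3_of_lfTop_ae`. -/
theorem unitEnvelope_of_package :
    ∀ (L : ℕ), ∃ γ₁ : ℝ, 0 < γ₁ ∧ ∀ (F : T3Family) (γ : ℝ), F.L = L → 0 < γ → γ ≤ γ₁ →
      ∃ Cl : ℝ, ∀ K : ℕ, ∀ᵐ V ∂(fieldMeasure (F.P K) K (Matrix.specialUnitaryGroup (Fin 2) ℂ)),
        emlDensity F γ K K V ≤
          Real.exp Cl * partitionFn (G := Matrix.specialUnitaryGroup (Fin 2) ℂ) (F.P K) ((F.scheme ℰp γ).β K) :=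
  stub_unitEnvelope_of_packageV3_of_lfTop_ae (hpkg_of_laneRecordsV3 stub_laneRecordsV3)
    (fun F => (⟨fun _ _ _ _ => ∅, fun _ _ _ _ => 0, fun _ _ Y => Y, fun _ _ _ => 0⟩ : AlphaInputsT3AC.PolymerT3 F))
    (lfTop_ae_of_hJ _)

/-! ## §2 The probability door: S-step → S-low → ⟨`hP♭`⟩ (sorry-free, rate-blind; (2)∕(6) by name) -/

/-- **THE PINNED HEIGHT TAIL WITH A FREE RATE PROFILE (`hP♭`: ✓p742302's `hP` with `(b, p)` in the rate) FROM THE TWO Z-LEVEL STUBS.**  Per `(K, j, a)`: `Gibbs_K(E) = (∫ ρ^E_K) ∕ Z_K` by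
✓`real_gibbsK_iter_mem` (level `0`) and ✓`integral_resDensity_mul` (test function `1`); the numerator is `≤ (e^{Cl}·Z_K)·e^{Cu}·w` by
`integral_mono_ae` (✓`integrable_resDensity`; product Haar is a probability measure) from S-step fed with S-low's a.e. envelope `M := e^{Cl}·Z_K`.
[cite: Balaban1985UV3, (2) p.256, (6)-(7) p.257] -/
theorem pinnedHeightTail_of
    (hStep : ∀ (L : ℕ), ∃ (b₁' p₁' : ℝ), ∀ (b₀ p₀ : ℝ), b₁' ≤ b₀ → p₁' ≤ p₀ → 0 < b₀ → 2 < p₀ → ∀ (m : ℕ), 0 < m →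
      ∃ γ₁ : ℝ, 0 < γ₁ ∧ γ₁ ≤ 1 ∧ ∀ (F : T3Family) (γ : ℝ), F.L = L → 0 < γ → γ ≤ γ₁ →
        ∃ (b p Cu c : ℝ) (A : ℕ), 0 < b ∧ 1 ≤ p ∧ 0 < c ∧
          ∀ (K j : ℕ), 1 ≤ j → j + 2 ≤ K → j + (K - 1) / m ≤ K → ∀ (a : Plaq (F.P K) j) (M : ℝ),
          (∀ᵐ V ∂(fieldMeasure (F.P K) K (Matrix.specialUnitaryGroup (Fin 2) ℂ)), emlDensity F γ K K V ≤ M) →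
          ∀ᵐ V ∂(fieldMeasure (F.P K) K (Matrix.specialUnitaryGroup (Fin 2) ℂ)),
            resDensity F γ K
              ({U : GaugeField (F.P K) 0 (Matrix.specialUnitaryGroup (Fin 2) ℂ) |
                  θBal F.L γ b₀ p₀ (K - j) ≤ GaugeGroup.dist1 (GaugeField.plaqHol
                    (Averaging.iter (fun i' => BlockAveraging.blockAvg (P := F.P K) (j := i') ℰp) j U) a)} ∩
                {U : GaugeField (F.P K) 0 (Matrix.specialUnitaryGroup (Fin 2) ℂ) | ∀ i, i < j →
                  PlaqSmall (θBal F.L γ b₀ p₀ (K - i))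
                    (Averaging.iter (fun i' => BlockAveraging.blockAvg (P := F.P K) (j := i') ℰp) i U)})
              K V ≤
            M * Real.exp Cu *
              ((F.scheme ℰp γ).β (K - j) ^ A * Real.exp (-(c * B10.pFun b p (Real.sqrt (γ * ((F.L : ℝ)⁻¹) ^ (K - j))) ^ 2))))
    (hLow : ∀ (L : ℕ), ∃ γ₁ : ℝ, 0 < γ₁ ∧ ∀ (F : T3Family) (γ : ℝ), F.L = L → 0 < γ → γ ≤ γ₁ →
      ∃ Cl : ℝ, ∀ K : ℕ, ∀ᵐ V ∂(fieldMeasure (F.P K) K (Matrix.specialUnitaryGroup (Fin 2) ℂ)),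
        emlDensity F γ K K V ≤
          Real.exp Cl * partitionFn (G := Matrix.specialUnitaryGroup (Fin 2) ℂ) (F.P K) ((F.scheme ℰp γ).β K)) :
    ∀ (L : ℕ), ∃ (b₁' p₁' : ℝ), ∀ (b₀ p₀ : ℝ), b₁' ≤ b₀ → p₁' ≤ p₀ → 0 < b₀ → 2 < p₀ → ∀ (m : ℕ), 0 < m →
      ∃ γ₁ : ℝ, 0 < γ₁ ∧ γ₁ ≤ 1 ∧ ∀ (F : T3Family) (γ : ℝ), F.L = L → 0 < γ → γ ≤ γ₁ →
        ∃ (b p C c : ℝ) (A : ℕ), 0 < b ∧ 1 ≤ p ∧ 0 ≤ C ∧ 0 < c ∧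
          ∀ (K j : ℕ), 1 ≤ j → j + 2 ≤ K → j + (K - 1) / m ≤ K → ∀ a : Plaq (F.P K) j,
          (gibbsK F ℰp γ K).real
              ({U : GaugeField (F.P K) 0 (Matrix.specialUnitaryGroup (Fin 2) ℂ) |
                  θBal F.L γ b₀ p₀ (K - j) ≤ GaugeGroup.dist1 (GaugeField.plaqHol
                    (Averaging.iter (fun i' => BlockAveraging.blockAvg (P := F.P K) (j := i') ℰp) j U) a)} ∩
                {U : GaugeField (F.P K) 0 (Matrix.specialUnitaryGroup (Fin 2) ℂ) | ∀ i, i < j →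
                  PlaqSmall (θBal F.L γ b₀ p₀ (K - i))
                    (Averaging.iter (fun i' => BlockAveraging.blockAvg (P := F.P K) (j := i') ℰp) i U)}) ≤
            C * (F.scheme ℰp γ).β (K - j) ^ A *
              Real.exp (-(c * B10.pFun b p (Real.sqrt (γ * ((F.L : ℝ)⁻¹) ^ (K - j))) ^ 2)) := by
  intro L
  obtain ⟨b₁', p₁', HS⟩ := hStep L
  obtain ⟨γL, hγL, HL⟩ := hLow L
  refine ⟨b₁', p₁', fun b₀ p₀ hb hp hb₀ hp₀ m hm => ?_⟩
  obtain ⟨γ₁, hγ₁, hγ₁1, HF⟩ := HS b₀ p₀ hb hp hb₀ hp₀ m hm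
  refine ⟨min γ₁ γL, lt_min hγ₁ hγL, (min_le_left _ _).trans hγ₁1, fun F γ hFL hγ hγle => ?_⟩
  obtain ⟨b, p, Cu, c, A, hb0, hp1, hc, hstep⟩ := HF F γ hFL hγ (hγle.trans (min_le_left _ _))
  obtain ⟨Cl, hlow⟩ := HL F γ hFL hγ (hγle.trans (min_le_right _ _))
  refine ⟨b, p, Real.exp (Cu + Cl), c, A, hb0, hp1, (Real.exp_pos _).le, hc, fun K j hj1 hjK hjm a => ?_⟩
  -- names
  set E : Set (GaugeField (F.P K) 0 (Matrix.specialUnitaryGroup (Fin 2) ℂ)) :=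
    {U : GaugeField (F.P K) 0 (Matrix.specialUnitaryGroup (Fin 2) ℂ) |
        θBal F.L γ b₀ p₀ (K - j) ≤ GaugeGroup.dist1 (GaugeField.plaqHol
          (Averaging.iter (fun i' => BlockAveraging.blockAvg (P := F.P K) (j := i') ℰp) j U) a)} ∩
      {U : GaugeField (F.P K) 0 (Matrix.specialUnitaryGroup (Fin 2) ℂ) | ∀ i, i < j →
        PlaqSmall (θBal F.L γ b₀ p₀ (K - i))
          (Averaging.iter (fun i' => BlockAveraging.blockAvg (P := F.P K) (j := i') ℰp) i U)} with hEdef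
  set w : ℝ := (F.scheme ℰp γ).β (K - j) ^ A *
    Real.exp (-(c * B10.pFun b p (Real.sqrt (γ * ((F.L : ℝ)⁻¹) ^ (K - j))) ^ 2)) with hwdef
  set Z : ℝ := partitionFn (G := Matrix.specialUnitaryGroup (Fin 2) ℂ) (F.P K) ((F.scheme ℰp γ).β K) with hZdef
  have hγ0 : 0 ≤ γ := hγ.le
  have hw : 0 ≤ w := mul_nonneg (pow_nonneg (F.scheme_β_nonneg ℰp hγ0 (K - j)) A) (Real.exp_nonneg _)
  have hZ : 0 < Z := partitionFn_pos' _ (F.scheme_β_nonneg ℰp hγ0 K)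
  -- measurability of the event
  have hiter : ∀ i : ℕ, Measurable (Averaging.iter (fun i' => BlockAveraging.blockAvg (P := F.P K) (j := i') ℰp) i) := fun i =>
    T4Continuum.measurable_iter _ (F.avgMeasurable_of_measurableE ℰp measurableE_ℰp K) i
  have hE1 : MeasurableSet {U : GaugeField (F.P K) 0 (Matrix.specialUnitaryGroup (Fin 2) ℂ) |
      θBal F.L γ b₀ p₀ (K - j) ≤ GaugeGroup.dist1 (GaugeField.plaqHol
        (Averaging.iter (fun i' => BlockAveraging.blockAvg (P := F.P K) (j := i') ℰp) j U) a)} :=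
    measurableSet_le measurable_const
      (RegularGaugeGroup.measurable_dist1.comp ((measurable_plaqHol a).comp (hiter j)))
  have hE2 : MeasurableSet {U : GaugeField (F.P K) 0 (Matrix.specialUnitaryGroup (Fin 2) ℂ) | ∀ i, i < j →
      PlaqSmall (θBal F.L γ b₀ p₀ (K - i))
        (Averaging.iter (fun i' => BlockAveraging.blockAvg (P := F.P K) (j := i') ℰp) i U)} := by
    have hset : {U : GaugeField (F.P K) 0 (Matrix.specialUnitaryGroup (Fin 2) ℂ) | ∀ i, i < j →
        PlaqSmall (θBal F.L γ b₀ p₀ (K - i))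
          (Averaging.iter (fun i' => BlockAveraging.blockAvg (P := F.P K) (j := i') ℰp) i U)} =
        histGood F ℰp (θBal F.L γ b₀ p₀) K (K - j + 1) := by
      ext U
      simp only [histGood, Set.mem_setOf_eq]
      exact ⟨fun h i hi => h i (by omega), fun h i hi => h i (by omega)⟩
    rw [hset]
    exact measurableSet_histGood F ℰp measurableE_ℰp _ K _
  have hE : MeasurableSet E := hE1.inter hE2
  -- (2)/(6): the Gibbs probability of `E` is the integral of the final restricted density over `Z_K`
  have hrepr : (gibbsK F ℰp γ K).real E =
      (∫ V, resDensity F γ K E K V ∂fieldMeasure (F.P K) K (Matrix.specialUnitaryGroup (Fin 2) ℂ)) / Z := by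
    have e := real_gibbsK_iter_mem F hγ0 K 0 (Nat.zero_le _) hE
    have e' : (gibbsK F ℰp γ K).real E =
        (∫ V in E, emlDensity F γ K 0 V ∂fieldMeasure (F.P K) 0 (Matrix.specialUnitaryGroup (Fin 2) ℂ)) / Z := e
    rw [e', ← integral_indicator hE]
    congr 1
    have h1 := integral_resDensity_mul F K hE hγ0 (k := K) (Nat.le_add_left K F.m) (fun _ => (1 : ℝ)) measurable_const
      ⟨1, fun _ => by simp⟩
    simp only [mul_one] at h1
    rw [h1]
    rfl
  -- a.e.: ρ^E_K ≤ (e^{Cl}·Z_K)·e^{Cu}·w — S-step fed with S-low's a.e. envelope `M := e^{Cl}·Z_K`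
  have hae : ∀ᵐ V ∂(fieldMeasure (F.P K) K (Matrix.specialUnitaryGroup (Fin 2) ℂ)),
      resDensity F γ K E K V ≤ (Real.exp Cl * Z) * Real.exp Cu * w :=
    hstep K j hj1 hjK hjm a (Real.exp Cl * Z) (hlow K)
  -- integrate over the last fibre (product Haar is a probability measure)
  haveI : IsProbabilityMeasure (fieldMeasure (F.P K) K (Matrix.specialUnitaryGroup (Fin 2) ℂ)) :=
    isProbabilityMeasure_fieldMeasure _ _
  have hnum : (∫ V, resDensity F γ K E K V ∂fieldMeasure (F.P K) K (Matrix.specialUnitaryGroup (Fin 2) ℂ)) ≤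
      (Real.exp Cl * Z) * Real.exp Cu * w := by
    have hmono := integral_mono_ae (integrable_resDensity F K hE hγ0 (k := K) (Nat.le_add_left K F.m))
      (integrable_const ((Real.exp Cl * Z) * Real.exp Cu * w)) hae
    simpa [integral_const, smul_eq_mul] using hmono
  -- assemble
  rw [hrepr, div_le_iff₀ hZ]
  calc (∫ V, resDensity F γ K E K V ∂fieldMeasure (F.P K) K (Matrix.specialUnitaryGroup (Fin 2) ℂ))
      ≤ (Real.exp Cl * Z) * Real.exp Cu * w := hnum
    _ = Real.exp (Cu + Cl) * ((F.scheme ℰp γ).β (K - j) ^ A *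
          Real.exp (-(c * B10.pFun b p (Real.sqrt (γ * ((F.L : ℝ)⁻¹) ^ (K - j))) ^ 2))) * Z := by
        rw [Real.exp_add, hwdef]; ring
    _ = Real.exp (Cu + Cl) * (F.scheme ℰp γ).β (K - j) ^ A *
          Real.exp (-(c * B10.pFun b p (Real.sqrt (γ * ((F.L : ℝ)⁻¹) ^ (K - j))) ^ 2)) * Z := by ring

/-! ## §3 The socket K-19′ BY NAME: ✓p748552 `UnitScaleTiltHistoryTailOfPinnedHeightTailFreeRate.historyTailL_of_pinnedHeightTail_freeRate (hP′)` (the LEAD's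
Theorems-side socket at a FREE rate profile; its `hP′` ≡ §2's conclusion — critic #369c P1 PAID: the v3 inline K-19♭ is deleted, no content change) -/

/-! ## §4 The crux BY NAME — the UNIQUE local concluder (★★OWNER RULING №39: zero extra hypotheses; §1b + §2 + K-19′) -/

/-- **`UnitScaleTilt.HistoryTailL` FROM THE TWO REGISTERED ROWS** `stub_laneRecordsV3`, `stub_hJ` (via §1a∕§1b the v3 texts, §2 the probability door, ✓p748552 the socket).
CONDITIONAL on the two sorried rows; nothing of the crux is proved. -/
theorem HistoryTailL_of_stubs : Summit.QuantumFields.YangMills.Theses.UnitScaleTilt.HistoryTailL :=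
  historyTailL_of_pinnedHeightTail_freeRate (pinnedHeightTail_of pinnedStep_of_package unitEnvelope_of_package)

end Summit.QuantumFields.YangMills.Cruxes.HistoryTailL.PinnedStability
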